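import Summits.Ventures.CertifiedArithmetic.LowPrec.GemmThetaLawSym

/-!
# Symbolic round-to-nearest-even on INTERVAL parameter domains (`K = M/M₀`, `T` in an affine interval)

HONEST FRAMING (venture CertifiedArithmetic / cell `pub-lowprec`, seat gemm, gen 12 → 13): certified
error envelopes and provably optimal rounding/accumulation schemes for low-precision formats under
stated cost models; every table by two implementations; no hardware or vendor claims.

`GemmThetaLawSym.lean` decides affine inequalities on ONE fixed parameter domain (`H ≥ 128`,
`36 ≤ T ≤ H - 37`) — enough for the E2M1² law (`GemmThetaLawE2M1.lean`), whose explicit binade-end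
bands are narrow.  For the FP6 and mixed product alphabets of paper `gemm.tex` Theorems t:thetap6 /
t:thetapmix the bands would be thousands of vertices wide, so the symbolic classes must be
LETTER-DEPENDENT: per (binade, letter, target binade, residue) one class whose free trailing
significand `T` ranges over an interval with bounds affine in the precision symbol.  This file is that
generalisation and nothing else: an interval domain `IDom` in the symbols `K` (the precision symbol,
`2^m = M₀·K`, `K ≥ K₀` even — or `K = K₀` when `fixed`) and `T` (`L₀ + L₁K ≤ T ≤ U₀ + U₁K`, or `T = 0`);
`nonnegOnI` decides `f ≥ 0` on it from the two vertices at `K₀` and the two recession directions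
(`nonnegOnI_sound`); `tryBinadeI` / `symRneI` round a symbolic magnitude `a + b·K + c·T` to `m + 1`
significant bits when binade, remainder and significand parity are determined by the form
(`symRneI_sound`: the value is `rneSigMag m` of the evaluated input at EVERY parameter of the domain).
The affine forms `AForm`, targets `Tgt` and `ceilHalf` are those of `GemmThetaLawSym.lean`.
Design aid (not a certificate): `code/gemm/thetalaw/symsplit_proto.py` of the cell evaluates the
letter-dependent classes for all six product alphabets with these primitives (0 failures).
-/

namespace Literature.ComputerArithmetic.FloatingPoint

namespace MiniFloat

namespace ThetaLaw

open AForm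

/-! ### Interval parameter domains -/

/-- An interval parameter domain for the symbols `K` (precision: `2^m = M₀·K`) and `T` (free trailing
significand): `K = K₀` if `fixed`, else `K ≥ K₀`; `L₀ + L₁·K ≤ T ≤ U₀ + U₁·K` if `hasT`, else `T = 0`.
[cell, gemm.tex Thms t:thetap6 / t:thetapmix, kernel plan] -/
structure IDom where
  /-- least (or, if `fixed`, the only) value of `K` -/
  K0 : ℤ
  /-- `K` is the fixed value `K0` (a numeric precision) -/
  fixed : Bool
  /-- the class has a free parameter `T` -/
  hasT : Bool
  /-- lower bound of `T`: constant part -/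
  L0 : ℤ
  /-- lower bound of `T`: coefficient of `K` -/
  L1 : ℤ
  /-- upper bound of `T`: constant part -/
  U0 : ℤ
  /-- upper bound of `T`: coefficient of `K` -/
  U1 : ℤ
  deriving DecidableEq, Repr

/-- Membership of a parameter pair in the domain. [cell] -/
def IDom.mem (d : IDom) (K T : ℤ) : Prop :=
  (d.fixed = true → K = d.K0) ∧ d.K0 ≤ K ∧
    (d.hasT = true → d.L0 + d.L1 * K ≤ T ∧ T ≤ d.U0 + d.U1 * K) ∧ (d.hasT = false → T = 0)

/-- `f ≥ 0` ON THE WHOLE DOMAIN: the two vertices at `K = K₀` and (unless `fixed`) the recession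
directions `(1, L₁)`, `(1, U₁)`. [cell; elementary polyhedral reasoning] -/
def nonnegOnI (d : IDom) (f : AForm) : Bool :=
  if d.hasT then
    decide (0 ≤ f.eval d.K0 (d.L0 + d.L1 * d.K0)) && decide (0 ≤ f.eval d.K0 (d.U0 + d.U1 * d.K0)) &&
      (d.fixed || (decide (0 ≤ f.b + f.c * d.L1) && decide (0 ≤ f.b + f.c * d.U1)))
  else decide (0 ≤ f.eval d.K0 0) && (d.fixed || decide (0 ≤ f.b))

/-- SOUNDNESS of `nonnegOnI`: the form is non-negative at every parameter of the domain (no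
non-emptiness hypothesis is needed: along `T = L(K)` and `T = U(K)` the form is affine in `K` with the
recession slopes, and for fixed `K` it is affine in `T` between the two bounds). [cell] -/
theorem nonnegOnI_sound {d : IDom} {f : AForm} {K T : ℤ} (h : nonnegOnI d f = true)
    (hd : d.mem K T) : 0 ≤ f.eval K T := by
  obtain ⟨hfix, hK, hT1, hT0⟩ := hd
  unfold nonnegOnI at h
  cases hT : d.hasT
  · rw [hT] at h
    simp only [Bool.false_eq_true, if_false, Bool.and_eq_true, decide_eq_true_eq,
      Bool.or_eq_true] at h
    obtain ⟨h0, hb⟩ := h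
    have hTz : T = 0 := hT0 hT
    subst hTz
    unfold AForm.eval at h0 ⊢
    cases hF : d.fixed
    · rw [hF] at hb
      simp only [Bool.false_eq_true, false_or] at hb
      have h1 : 0 ≤ f.b * (K - d.K0) := mul_nonneg hb (by linarith)
      nlinarith
    · have hKe : K = d.K0 := hfix hF
      subst hKe; linarith
  · rw [hT] at h
    simp only [if_true, Bool.and_eq_true, decide_eq_true_eq, Bool.or_eq_true] at h
    obtain ⟨⟨hL, hU⟩, hrec⟩ := h
    obtain ⟨hTlo, hThi⟩ := hT1 hT
    unfold AForm.eval at hL hU ⊢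
    cases hF : d.fixed
    · rw [hF] at hrec
      simp only [Bool.false_eq_true, false_or] at hrec
      obtain ⟨hbL, hbU⟩ := hrec
      have h1 : 0 ≤ (f.b + f.c * d.L1) * (K - d.K0) := mul_nonneg hbL (by linarith)
      have h2 : 0 ≤ (f.b + f.c * d.U1) * (K - d.K0) := mul_nonneg hbU (by linarith)
      by_cases hc : 0 ≤ f.c
      · have h3 : 0 ≤ f.c * (T - (d.L0 + d.L1 * K)) := mul_nonneg hc (by linarith)
        nlinarith
      · have h3 : 0 ≤ f.c * (T - (d.U0 + d.U1 * K)) := by nlinarith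
        nlinarith
    · have hKe : K = d.K0 := hfix hF
      subst hKe
      by_cases hc : 0 ≤ f.c
      · have h3 : 0 ≤ f.c * (T - (d.L0 + d.L1 * d.K0)) := mul_nonneg hc (by linarith)
        nlinarith
      · have h3 : 0 ≤ f.c * (T - (d.U0 + d.U1 * d.K0)) := by nlinarith
        nlinarith

/-! ### Symbolic round-to-nearest-even on an interval domain -/

/-- ROUND A SYMBOLIC MAGNITUDE `n = a + b·K + c·T` IN THE BINADE OF SPACING `2^e` (`M₀K·2^e ≤ n <
2M₀K·2^e` on the whole domain): needs `2^e ∣ b`, `2^e ∣ c` with an even `T`-quotient (then, `K` being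
even, remainder and significand parity are those of the constant coefficient); rounds half-to-even.
[cell, gemm.tex Thms t:thetap / t:thetap6 / t:thetapmix proofs: the `p`-free rounding rules at once] -/
def tryBinadeI (d : IDom) (M0 : ℤ) (n : AForm) (e : ℕ) : Option Tgt :=
  if n.b % 2 ^ e = 0 ∧ n.c % 2 ^ e = 0 ∧ (n.c / 2 ^ e) % 2 = 0 ∧
      nonnegOnI d (n.sub (hH (M0 * 2 ^ e))) = true ∧
      nonnegOnI d (((hH (2 * M0 * 2 ^ e)).sub n).sub (const 1)) = true then
    some (Tgt.big e
      ((AForm.mk (n.a / 2 ^ e) (n.b / 2 ^ e) (n.c / 2 ^ e)).add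
        (const (if 2 * (n.a % 2 ^ e) < 2 ^ e then 0
                else if (2 : ℤ) ^ e < 2 * (n.a % 2 ^ e) then 1 else (n.a / 2 ^ e) % 2))))
  else none

/-- `symRneI d M₀ hints n`: round the symbolic magnitude `n` to `m + 1` significant bits
(`2^m = M₀K`) — the first binade of `hints` that applies, else exact if `0 ≤ n < 2M₀K = 2^(m+1)` on the
domain, else give up. [cell] -/
def symRneI (d : IDom) (M0 : ℤ) (hints : List ℕ) (n : AForm) : Option Tgt :=
  match hints.findSome? (tryBinadeI d M0 n) with
  | some t => some t
  | none =>
      if nonnegOnI d n = true ∧ nonnegOnI d (((hH (2 * M0)).sub n).sub (const 1)) = true then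
        some (Tgt.small n)
      else none

/-- SOUNDNESS OF `tryBinadeI`: at every parameter of the domain with `K` even and `2^m = M₀K`, the
evaluated target is `rneSigMag m` of the evaluated input and its significand lies in `[M₀K, 2M₀K]`.
[cell; `rneSigMag_of_binade`, `rneShiftNat_of_decomp`] -/
theorem tryBinadeI_sound {d : IDom} {M0 : ℤ} {n : AForm} {e : ℕ} {tg : Tgt} {K T : ℤ} {m : ℕ}
    (h : tryBinadeI d M0 n e = some tg) (hd : d.mem K T) (hev : 2 ∣ K)
    (hM : (2 : ℤ) ^ m = M0 * K) :
    ∃ sig, tg = Tgt.big e sig ∧ M0 * K ≤ sig.eval K T ∧ sig.eval K T ≤ 2 * M0 * K ∧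
      0 ≤ n.eval K T ∧ ((rneSigMag m (n.eval K T).toNat : ℕ) : ℤ) = sig.eval K T * 2 ^ e := by
  unfold tryBinadeI at h
  obtain ⟨hc, h⟩ := Option.ite_none_right_eq_some.mp h
  obtain ⟨hb, hcd, hpar, hlo, hhi⟩ := hc
  simp only [Option.some.injEq] at h
  subst h
  refine ⟨_, rfl, ?_⟩
  have hP : (0 : ℤ) < 2 ^ e := by positivity
  have hMK : 0 < M0 * K := by rw [← hM]; positivity
  have hlo' := nonnegOnI_sound hlo hd
  have hhi' := nonnegOnI_sound hhi hd
  simp only [eval_sub, eval_hH, eval_const] at hlo' hhi'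
  set P : ℤ := 2 ^ e with hPdef
  set q0 := n.a / P with hq0
  set r := n.a % P with hr
  have hr0 : 0 ≤ r := Int.emod_nonneg _ (ne_of_gt hP)
  have hrP : r < P := Int.emod_lt_of_pos _ hP
  have ha : n.a = q0 * P + r := by
    have := Int.emod_add_ediv_mul n.a P
    rw [hq0, hr]; linarith
  obtain ⟨b', hb'⟩ : P ∣ n.b := Int.dvd_of_emod_eq_zero hb
  obtain ⟨c', hc'⟩ : P ∣ n.c := Int.dvd_of_emod_eq_zero hcd
  have hbq : n.b / P = b' := by rw [hb', Int.mul_ediv_cancel_left _ (ne_of_gt hP)]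
  have hcq : n.c / P = c' := by rw [hc', Int.mul_ediv_cancel_left _ (ne_of_gt hP)]
  obtain ⟨c'', hc''⟩ : 2 ∣ c' := by rw [← hcq]; exact Int.dvd_of_emod_eq_zero hpar
  obtain ⟨K', hK'⟩ := hev
  set Q := q0 + b' * K + c' * T with hQ
  have hN : n.eval K T = Q * P + r := by
    unfold AForm.eval; rw [ha, hb', hc', hQ]; ring
  have hQlo : M0 * K ≤ Q := by nlinarith
  have hQhi : Q ≤ 2 * M0 * K - 1 := by nlinarith
  have hQ0 : 0 ≤ Q := by linarith
  have hQpar : Q % 2 = q0 % 2 := by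
    have : Q = q0 + 2 * (b' * K' + c'' * T) := by rw [hQ, hK', hc'']; ring
    omega
  have hsig : ((AForm.mk (n.a / P) (n.b / P) (n.c / P)).add
      (const (if 2 * (n.a % P) < P then 0 else if P < 2 * (n.a % P) then 1 else (n.a / P) % 2))).eval K T
      = Q + (if 2 * r < P then 0 else if P < 2 * r then 1 else Q % 2) := by
    simp only [eval_add, eval_mk, eval_const, hbq, hcq, ← hq0, ← hr, hQpar]
    rw [hQ]
  rw [hsig]
  have hρ0 : (0 : ℤ) ≤ (if 2 * r < P then 0 else if P < 2 * r then 1 else Q % 2) := by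
    split_ifs <;> omega
  have hρ1 : (if 2 * r < P then 0 else if P < 2 * r then 1 else Q % 2) ≤ (1 : ℤ) := by
    split_ifs <;> omega
  have hN0 : 0 ≤ n.eval K T := by rw [hN]; nlinarith
  refine ⟨by linarith, by linarith, hN0, ?_⟩
  have hQcast : ((Q.toNat : ℕ) : ℤ) = Q := Int.toNat_of_nonneg hQ0
  have hrcast : ((r.toNat : ℕ) : ℤ) = r := Int.toNat_of_nonneg hr0
  have hNcast : (((n.eval K T).toNat : ℕ) : ℤ) = n.eval K T := Int.toNat_of_nonneg hN0
  have hNnat : (n.eval K T).toNat = Q.toNat * 2 ^ e + r.toNat := by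
    have h1 : (((n.eval K T).toNat : ℕ) : ℤ) = ((Q.toNat * 2 ^ e + r.toNat : ℕ) : ℤ) := by
      push_cast; rw [hNcast, hQcast, hrcast, hN]
    exact_mod_cast h1
  have hrnat : r.toNat < 2 ^ e := by
    have : ((r.toNat : ℕ) : ℤ) < ((2 ^ e : ℕ) : ℤ) := by push_cast; rw [hrcast]; exact hrP
    exact_mod_cast this
  have h2m : (2 : ℤ) ^ (m + e) = M0 * K * P := by rw [pow_add, hM]
  have hloN : 2 ^ (m + e) ≤ (n.eval K T).toNat := by
    have : ((2 ^ (m + e) : ℕ) : ℤ) ≤ (((n.eval K T).toNat : ℕ) : ℤ) := by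
      push_cast; rw [hNcast, h2m, hN]; nlinarith
    exact_mod_cast this
  have hhiN : (n.eval K T).toNat < 2 ^ (m + e + 1) := by
    have : (((n.eval K T).toNat : ℕ) : ℤ) < ((2 ^ (m + e + 1) : ℕ) : ℤ) := by
      push_cast; rw [hNcast, pow_succ, h2m, hN]; nlinarith
    exact_mod_cast this
  rw [rneSigMag_of_binade hloN hhiN, hNnat, rneShiftNat_of_decomp _ hrnat]
  have hc1 : (2 * r.toNat < 2 ^ e) ↔ (2 * r < P) := by
    rw [← Nat.cast_lt (α := ℤ)]; push_cast; rw [hrcast]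
  have hc2 : (2 ^ e < 2 * r.toNat) ↔ (P < 2 * r) := by
    rw [← Nat.cast_lt (α := ℤ)]; push_cast; rw [hrcast]
  by_cases h1 : 2 * r < P
  · rw [if_pos (hc1.mpr h1), if_pos h1]; push_cast; rw [hQcast]; try ring
  · rw [if_neg (mt hc1.mp h1), if_neg h1]
    by_cases h2 : P < 2 * r
    · rw [if_pos (hc2.mpr h2), if_pos h2]; push_cast; rw [hQcast]; try ring
    · rw [if_neg (mt hc2.mp h2), if_neg h2]; push_cast; rw [hQcast]; try ring

/-- SOUNDNESS OF `symRneI`, binade case and exact case together: the evaluated target value is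
`rneSigMag m` of the evaluated input at every parameter of the domain. [cell] -/
theorem symRneI_sound {d : IDom} {M0 : ℤ} {hints : List ℕ} {n : AForm} {tg : Tgt} {K T : ℤ} {m : ℕ}
    (h : symRneI d M0 hints n = some tg) (hd : d.mem K T) (hev : 2 ∣ K)
    (hM : (2 : ℤ) ^ m = M0 * K) :
    0 ≤ n.eval K T ∧ ((rneSigMag m (n.eval K T).toNat : ℕ) : ℤ) = tg.val.eval K T ∧
      (∀ e sig, tg = Tgt.big e sig → M0 * K ≤ sig.eval K T ∧ sig.eval K T ≤ 2 * M0 * K) ∧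
      (∀ n', tg = Tgt.small n' → n' = n ∧ n.eval K T < 2 * M0 * K) := by
  unfold symRneI at h
  split at h
  · rename_i t ht
    simp only [Option.some.injEq] at h
    subst h
    obtain ⟨e, -, he⟩ := List.exists_of_findSome?_eq_some ht
    obtain ⟨sig, rfl, h1, h2, h3, h4⟩ := tryBinadeI_sound he hd hev hM
    refine ⟨h3, ?_, ?_, ?_⟩
    · rw [h4]; simp [Tgt.val, mul_comm]
    · rintro e' sig' heq; cases heq; exact ⟨h1, h2⟩
    · rintro n' heq; cases heq
  · obtain ⟨⟨h0, h4⟩, h⟩ := Option.ite_none_right_eq_some.mp h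
    simp only [Option.some.injEq] at h
    subst h
    have h0' := nonnegOnI_sound h0 hd
    have h4' := nonnegOnI_sound h4 hd
    simp only [eval_sub, eval_hH, eval_const] at h4'
    refine ⟨h0', ?_, ?_, ?_⟩
    · simp only [Tgt.val]
      have hlt : (n.eval K T).toNat < 2 ^ (m + 1) := by
        have : ((n.eval K T).toNat : ℤ) < ((2 ^ (m + 1) : ℕ) : ℤ) := by
          rw [Int.toNat_of_nonneg h0']; push_cast; rw [pow_succ, hM]; linarith
        exact_mod_cast this
      unfold rneSigMag; rw [if_pos hlt, Int.toNat_of_nonneg h0']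
    · rintro e sig heq; cases heq
    · rintro n' heq; cases heq; exact ⟨rfl, by linarith⟩

/-- Sanity (kernel-checked), `M₀ = 64`, `K ≥ 2`: in binade `1` (spacing `4`) on the class `t = 2T + 1`,
`0 ≤ T ≤ 32K - 2`, the odd vertex `(64K + 2T + 1)·4` plus the letter `2` is a tie and rounds to the even
significand `64K + 2T + 2`; on the crossing class `t = 4T + 3`, `T = 16K - 1` (the last vertex of
binade `1`) the letter `6` gives `512K + 2`, which lies in binade `2` (spacing `8`, hint `3`) and rounds
down to that binade's first vertex `64K·8` (significand form `2 + 32K + 2T = 64K`); and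
`128K - 7 + 3 < 128K` is exact. [cell] -/
theorem symRneI_values :
    symRneI ⟨2, false, true, 0, 0, -2, 32⟩ 64 [2, 1, 3] ⟨6, 256, 8⟩ = some (Tgt.big 2 ⟨2, 64, 2⟩) ∧
    symRneI ⟨2, false, true, -1, 16, -1, 16⟩ 64 [3, 2] ⟨18, 256, 16⟩ = some (Tgt.big 3 ⟨2, 32, 2⟩) ∧
    symRneI ⟨2, false, false, 0, 0, 0, 0⟩ 64 [1] ⟨-4, 128, 0⟩ = some (Tgt.small ⟨-4, 128, 0⟩) := by
  decide

end ThetaLaw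

end MiniFloat

end Literature.ComputerArithmetic.FloatingPoint
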